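import Summits.NavierStokesRegularity.FluidComputer.TimeParity
import Summits.NavierStokesRegularity.FunctionalMining.NoGo.GalerkinReduction
import Mathlib.Analysis.Calculus.Deriv.CompMul
import HarnessLib

/-!
# Why Ohkitani's family coefficients are symmetric and homogeneous in `(A, B, C)`: the exact
# covariances of the truncated Euler system behind the structure `qₙ ∈ ℚ[s, p]`

HONEST FRAMING: typed infrastructure for a low prior, high value-of-information experiment on
Tao's machine paradigm; NOT a claim that NS blows up.

Ohkitani computes the Taylor coefficients of the enstrophy for the two-parameter family of data
`u = (A cos x sin y sin z, B sin x cos y sin z, C sin x sin y cos z)`, `A + B + C = 0`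
[cite: Ohkitani2001ODEEnstrophy, eq. (22)], finds `dⁿQ/dξⁿ(0)` (`ξ = t²`) to be polynomials in
`s = A² + AB + B²` and `p = A²B²(A+B)²` and writes "It is remarkable that these results are
polynomials in the particular combinations of A and B"
[cite: Ohkitani2001ODEEnstrophy, App. (A1)–(A2)].  The structure is forced by three exact
properties of the (truncated) Euler dynamics, of which this file types the two dynamical ones for
EVERY Galerkin truncation (the third, parity in `t`, is `TimeParity`):

* HOMOGENEITY (Euler's amplitude–time scaling `u ↦ r u(r t)`): `isGalerkinSolution_scaleTime` —
  if `û` solves the Galerkin system with viscosity `ν` then `t ↦ r û(r t)` solves it with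
  viscosity `r ν` (Reynolds similarity; for `ν = 0` the same system); by uniqueness the inviscid
  run from `r û(0)` IS `t ↦ r û(r t)` (`eq_scaleTime`), so `Z_T` of that run is `r² Z_T(r t)` and
  its `n`-th Taylor coefficient at `0` is `r^{n+2}` times that of the original run
  (`iteratedDeriv_truncEnstrophy_scaleTime`; the dilation rule for `iteratedDeriv` is proved here
  WITHOUT differentiability hypotheses).  For the family, `scale r (fam A B) = fam (rA) (rB)`
  (`scale_fam`), whence `fam_coeff_homogeneous`.
* PERMUTATION SYMMETRY (the axis permutations of the octahedral group permute `(A, B, C)`):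
  `swapXY_act_fam : swapXY · fam(A,B,C) = fam(B,A,C)` and
  `cycleXYZ_act_fam : cycle · fam(A,B,C) = fam(C,A,B)`; by equivariance
  (`LatticeIsometry.isGalerkinSolution_act`) and uniqueness the runs from permuted members are
  the permuted runs (`fam_swap_run`, `fam_cycle_run`), so on every truncation `S` and mode set
  `T` mapped into themselves by the permutation the enstrophy curves — hence all their Taylor
  coefficients — COINCIDE (`fam_swap_truncEnstrophy`, `fam_cycle_truncEnstrophy`,
  `fam_swap_coeff`, `fam_cycle_coeff`).

Consequence (prose; the remaining step is algebra + the polynomiality of Taylor jets of a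
polynomial ODE, not typed here): the `t^{2n}` coefficient of `Z/Z₀` is a homogeneous degree-`2n`
polynomial in `(A, B, C)` invariant under all permutations; on the plane `A + B + C = 0` the
symmetric polynomials are generated by `e₂ = -(A² + AB + B²) = -s` and `e₃ = ABC` (`e₃² = p`),
and degree `2n` forces `Σ_b β_{n,b} s^{n-3b} p^b` — Ohkitani's observation, and the interpolation
structure the cell's exact series tools use for members beyond print.  0 sorry, 0 named facts.
-/

noncomputable section

namespace Summit.NavierStokesRegularity.FluidComputer.FamilySymmetry

open Literature.Analysis.FluidPDE.FluidComputer
open Literature.Analysis.FluidPDE.FluidComputer.ShellTransfer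
open Literature.Analysis.FluidPDE.FluidComputer.ShellTransfer.TaylorGreenHat
open Summit.NavierStokesRegularity.FunctionalMining (Galerkin.truncEnstrophy_scale
  Galerkin.truncEnergy_scale)
open Complex
open scoped BigOperators

/-! ## Calculus without differentiability hypotheses: dilations and constants -/

/-- `(d/dτ)ⁿ[φ(cτ)](x) = cⁿ φ⁽ⁿ⁾(cx)` for every real `c` (also `c = 0`) and every `φ : ℝ → ℝ`, with
no differentiability hypothesis (Mathlib's `iteratedDeriv_comp_const_mul` asks for `ContDiff`; the
first-order rule `deriv_comp_mul_left` is unconditional and we iterate it). [folklore] -/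
theorem iteratedDeriv_comp_mul_left_real (φ : ℝ → ℝ) (c : ℝ) :
    ∀ (n : ℕ) (x : ℝ),
      iteratedDeriv n (fun τ => φ (c * τ)) x = c ^ n * iteratedDeriv n φ (c * x) := by
  intro n
  induction n with
  | zero => intro x; simp
  | succ n ih =>
    intro x
    have e : iteratedDeriv n (fun τ => φ (c * τ)) = fun τ => c ^ n * iteratedDeriv n φ (c * τ) :=
      funext ih
    rw [iteratedDeriv_succ, e, deriv_const_mul_field, deriv_comp_mul_left, smul_eq_mul,
      iteratedDeriv_succ]
    ring

/-- `(d/dτ)ⁿ[a φ](x) = a φ⁽ⁿ⁾(x)` with no differentiability hypothesis. [folklore] -/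
theorem iteratedDeriv_const_mul_real (a : ℝ) (φ : ℝ → ℝ) :
    ∀ (n : ℕ) (x : ℝ), iteratedDeriv n (fun τ => a * φ τ) x = a * iteratedDeriv n φ x := by
  intro n
  induction n with
  | zero => intro x; simp
  | succ n ih =>
    intro x
    have e : iteratedDeriv n (fun τ => a * φ τ) = fun τ => a * iteratedDeriv n φ τ := funext ih
    rw [iteratedDeriv_succ, e, deriv_const_mul_field, iteratedDeriv_succ]

/-! ## Euler's amplitude–time scaling on the truncated system -/

variable {U V : ℝ → FourierVelocity} {S : Finset (Fin 3 → ℤ)} {c c' : ℝ → (Fin 3 → ℤ) → ℂ}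

/-- **AMPLITUDE–TIME SCALING (Reynolds similarity) of the Galerkin system**: if `û` solves it with
viscosity `ν`, multiplier `c` and forcing `f`, then `t ↦ r û(r t)` solves it with viscosity `r ν`,
multiplier `r² c(r t)` and forcing `r² f(r t)` — the advection term is quadratic.
[cite: Frisch1995Turbulence, §2.2 p. 17 (scaling symmetries of Navier–Stokes)] -/
theorem isGalerkinSolution_scaleTime {ν : ℝ} {f : ℝ → (Fin 3 → ℤ) → Fin 3 → ℂ}
    (hU : IsGalerkinSolution U S ν c f) (r : ℝ) :
    IsGalerkinSolution (fun t => scale r (U (r * t))) S (r * ν)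
      (fun t k => (r : ℂ) ^ 2 * c (r * t) k) fun t k j => (r : ℂ) ^ 2 * f (r * t) k j := by
  intro t k hk j
  have e : (fun s => (scale r (U (r * s))).coeff k j)
      = fun s => (r : ℂ) * (U (r * s)).coeff k j := by
    funext s; rfl
  rw [e]
  have hlin : HasDerivAt (fun s : ℝ => r * s) r t := by
    simpa using (hasDerivAt_id t).const_mul r
  have h1 : HasDerivAt (fun s => (U (r * s)).coeff k j)
      (r • galerkinRHS (U (r * t)) S ν (c (r * t)) (f (r * t)) k j) t :=
    HasDerivAt.scomp t (hU (r * t) k hk j) hlin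
  refine (h1.const_mul (r : ℂ)).congr_deriv ?_
  rw [Complex.real_smul]
  unfold galerkinRHS
  rw [scale_coeff, advection_scale]
  push_cast
  ring

/-- The inviscid unforced case: `t ↦ r û(r t)` solves the SAME truncated Euler system. [folklore] -/
theorem isGalerkinSolution_scaleTime_euler (hU : IsGalerkinSolution U S 0 c fun _ _ _ => 0)
    (r : ℝ) :
    IsGalerkinSolution (fun t => scale r (U (r * t))) S 0 (fun t k => (r : ℂ) ^ 2 * c (r * t) k)
      fun _ _ _ => 0 := by
  have h := isGalerkinSolution_scaleTime hU r
  rw [mul_zero] at h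
  intro t k hk j
  refine (h t k hk j).congr_deriv ?_
  simp [galerkinRHS]

/-- Support is preserved by the scaling. [folklore] -/
theorem scaleTime_isSupportedOn (hs : IsSupportedOn U S) (r : ℝ) :
    IsSupportedOn (fun t => scale r (U (r * t))) S := by
  intro t k hk
  funext j
  rw [scale_coeff, hs (r * t) k hk]
  simp

/-- **The inviscid run from the rescaled datum `r û(0)` IS `t ↦ r û(r t)`** (uniqueness).
[folklore] -/
theorem eq_scaleTime (hU : IsGalerkinSolution U S 0 c fun _ _ _ => 0) (hs : IsSupportedOn U S)
    (hV : IsGalerkinSolution V S 0 c' fun _ _ _ => 0) (hsV : IsSupportedOn V S) {r : ℝ}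
    (h0 : V 0 = scale r (U 0)) (t : ℝ) : V t = scale r (U (r * t)) := by
  refine GalerkinODE.galerkin_unique S hV (isGalerkinSolution_scaleTime_euler hU r) hsV
    (scaleTime_isSupportedOn hs r) (t₀ := 0) ?_ t
  show V 0 = scale r (U (r * 0))
  rw [mul_zero]
  exact h0

/-- Hence its enstrophy curve (any mode set `T`) is `r² Z_T(r t)`. [folklore] -/
theorem truncEnstrophy_scaleTime (hU : IsGalerkinSolution U S 0 c fun _ _ _ => 0)
    (hs : IsSupportedOn U S) (hV : IsGalerkinSolution V S 0 c' fun _ _ _ => 0)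
    (hsV : IsSupportedOn V S) {r : ℝ} (h0 : V 0 = scale r (U 0)) (t : ℝ)
    (T : Finset (Fin 3 → ℤ)) : truncEnstrophy (V t) T = r ^ 2 * truncEnstrophy (U (r * t)) T := by
  rw [eq_scaleTime hU hs hV hsV h0 t, Galerkin.truncEnstrophy_scale]

/-- **… and its `n`-th Taylor coefficient at `t = 0` is `r^{n+2}` times that of the original run.**
[folklore] -/
theorem iteratedDeriv_truncEnstrophy_scaleTime (hU : IsGalerkinSolution U S 0 c fun _ _ _ => 0)
    (hs : IsSupportedOn U S) (hV : IsGalerkinSolution V S 0 c' fun _ _ _ => 0)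
    (hsV : IsSupportedOn V S) {r : ℝ} (h0 : V 0 = scale r (U 0)) (T : Finset (Fin 3 → ℤ))
    (n : ℕ) :
    iteratedDeriv n (fun t => truncEnstrophy (V t) T) 0
      = r ^ (n + 2) * iteratedDeriv n (fun t => truncEnstrophy (U t) T) 0 := by
  set φ : ℝ → ℝ := fun τ => truncEnstrophy (U τ) T with hφ
  have e : (fun t => truncEnstrophy (V t) T) = fun t => r ^ 2 * φ (r * t) := by
    funext t
    rw [truncEnstrophy_scaleTime hU hs hV hsV h0 t T]
  rw [e, iteratedDeriv_const_mul_real (r ^ 2) (fun t => φ (r * t)) n 0,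
    iteratedDeriv_comp_mul_left_real φ r n 0, mul_zero]
  ring

/-! ## The family under scaling and under the axis permutations -/

/-- `r · fam(A, B) = fam(rA, rB)`: the family is linear in its parameters. [folklore] -/
theorem scale_fam (r A B : ℝ) :
    scale r (TaylorGreenFamily.fam A B) = TaylorGreenFamily.fam (r * A) (r * B) := by
  refine fourierVelocity_ext ?_
  funext k j
  rw [scale_coeff, TaylorGreenFamily.coeff_eq_ite, TaylorGreenFamily.coeff_eq_ite]
  by_cases hk : k ∈ modes
  · rw [if_pos hk, if_pos hk]
    fin_cases j <;> simp <;> ring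
  · rw [if_neg hk, if_neg hk, mul_zero]

/-- Membership of `(k₁, k₂, k₀)` in the mode set `{±1}³`. [folklore] -/
theorem cycle_vec_mem_tgModes_iff (k : Fin 3 → ℤ) :
    (![k 1, k 2, k 0] : Fin 3 → ℤ) ∈ modes ↔ k ∈ modes := by
  rw [mem_modes, mem_modes]
  simp only [Matrix.cons_val_zero, Matrix.cons_val_one, Matrix.head_cons, Matrix.cons_val_two,
    Matrix.tail_cons]
  constructor
  · rintro ⟨h1, h2, h0⟩; exact ⟨h0, h1, h2⟩
  · rintro ⟨h0, h1, h2⟩; exact ⟨h1, h2, h0⟩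

/-- **`swapXY · fam(A, B, C) = fam(B, A, C)`**: exchanging `x` and `y` exchanges `A` and `B`.
[cite: Ohkitani2001ODEEnstrophy, eq. (22)] -/
theorem swapXY_act_fam (A B : ℝ) :
    swapXY.act (TaylorGreenFamily.fam A B) = TaylorGreenFamily.fam B A := by
  refine fourierVelocity_ext ?_
  funext k i
  rw [LatticeIsometry.act_coeff, swapXY_invK]
  simp only [TaylorGreenFamily.coeff_eq_ite, swap_vec_mem_tgModes_iff]
  by_cases hk : k ∈ modes
  · simp only [if_pos hk]
    unfold swapXY
    fin_cases i <;> simp [Fin.sum_univ_three, add_comm]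
  · simp only [if_neg hk, mul_zero, Finset.sum_const_zero]

/-- **`cycleXYZ · fam(A, B, C) = fam(C, A, B)`**: the coordinate 3-cycle cycles the parameters.
[cite: Ohkitani2001ODEEnstrophy, eq. (22)] -/
theorem cycleXYZ_act_fam (A B : ℝ) :
    cycleXYZ.act (TaylorGreenFamily.fam A B) = TaylorGreenFamily.fam (-(A + B)) A := by
  refine fourierVelocity_ext ?_
  funext k i
  rw [LatticeIsometry.act_coeff, cycleXYZ_invK]
  simp only [TaylorGreenFamily.coeff_eq_ite, cycle_vec_mem_tgModes_iff]
  by_cases hk : k ∈ modes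
  · simp only [if_pos hk]
    unfold cycleXYZ
    fin_cases i <;> simp [Fin.sum_univ_three]
  · simp only [if_neg hk, mul_zero, Finset.sum_const_zero]

/-! ## Runs from permuted / rescaled members are the permuted / rescaled runs -/

/-- A point-group element maps UNFORCED Galerkin solutions to unforced ones (on a mode set mapped
into itself by `Mᵀ`). [folklore] -/
theorem isGalerkinSolution_act_unforced (g : LatticeIsometry) {ν : ℝ}
    (hU : IsGalerkinSolution U S ν c fun _ _ _ => 0) (hS : ∀ p ∈ S, g.invK p ∈ S) :
    IsGalerkinSolution (fun t => g.act (U t)) S ν (fun t k => c t (g.invK k)) fun _ _ _ => 0 := by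
  have hg := g.isGalerkinSolution_act hU hS
  have hf : (fun (t : ℝ) (k : Fin 3 → ℤ) =>
      g.actV ((fun (_ : ℝ) (_ : Fin 3 → ℤ) (_ : Fin 3) => (0 : ℂ)) t (g.invK k)))
      = fun _ _ _ => 0 := by
    funext t k
    exact g.actV_zero
  rw [hf] at hg
  exact hg

/-- **Uniqueness form of equivariance**: if `V(0) = g · U(0)` then `V(t) = g · U(t)` (both unforced
inviscid runs supported in a mode set mapped into itself by `M` and `Mᵀ`). [folklore] -/
theorem eq_act (g : LatticeIsometry) {ν : ℝ} (hU : IsGalerkinSolution U S ν c fun _ _ _ => 0)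
    (hs : IsSupportedOn U S) (hV : IsGalerkinSolution V S ν c' fun _ _ _ => 0)
    (hsV : IsSupportedOn V S) (hS : ∀ p ∈ S, g.invK p ∈ S) (hS' : ∀ p ∈ S, g.actK p ∈ S)
    (h0 : V 0 = g.act (U 0)) (t : ℝ) : V t = g.act (U t) :=
  GalerkinODE.galerkin_unique S hV (isGalerkinSolution_act_unforced g hU hS) hsV
    (g.act_isSupportedOn hS' hs) (t₀ := 0) h0 t

/-- **HOMOGENEITY.** The inviscid run from the member `(rA, rB, rC)` is `t ↦ r û(r t)` where `û` is
the run from `(A, B, C)`. [folklore] -/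
theorem fam_scale_run {A B r : ℝ} (hU : IsGalerkinSolution U S 0 c fun _ _ _ => 0)
    (hs : IsSupportedOn U S) (hU0 : U 0 = TaylorGreenFamily.fam A B)
    (hV : IsGalerkinSolution V S 0 c' fun _ _ _ => 0) (hsV : IsSupportedOn V S)
    (hV0 : V 0 = TaylorGreenFamily.fam (r * A) (r * B)) (t : ℝ) : V t = scale r (U (r * t)) :=
  eq_scaleTime hU hs hV hsV (by rw [hV0, hU0, scale_fam]) t

/-- **… so the `n`-th Taylor coefficient of `Z_T` at `t = 0` is homogeneous of degree `n + 2` in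
`(A, B, C)`**: `Z_T⁽ⁿ⁾(0; rA, rB) = r^{n+2} Z_T⁽ⁿ⁾(0; A, B)` for every truncation and every mode
set.
[cite: Ohkitani2001ODEEnstrophy, App. (A1)] -/
theorem fam_coeff_homogeneous {A B r : ℝ} (hU : IsGalerkinSolution U S 0 c fun _ _ _ => 0)
    (hs : IsSupportedOn U S) (hU0 : U 0 = TaylorGreenFamily.fam A B)
    (hV : IsGalerkinSolution V S 0 c' fun _ _ _ => 0) (hsV : IsSupportedOn V S)
    (hV0 : V 0 = TaylorGreenFamily.fam (r * A) (r * B)) (T : Finset (Fin 3 → ℤ)) (n : ℕ) :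
    iteratedDeriv n (fun t => truncEnstrophy (V t) T) 0
      = r ^ (n + 2) * iteratedDeriv n (fun t => truncEnstrophy (U t) T) 0 :=
  iteratedDeriv_truncEnstrophy_scaleTime hU hs hV hsV (by rw [hV0, hU0, scale_fam]) T n

/-- **PERMUTATION SYMMETRY, transposition.** On a truncation `S` mapped into itself by the swap
`x ↔ y`, the inviscid run from `(B, A, C)` is the swapped run from `(A, B, C)`. [folklore] -/
theorem fam_swap_run {A B : ℝ} (hU : IsGalerkinSolution U S 0 c fun _ _ _ => 0)
    (hs : IsSupportedOn U S) (hU0 : U 0 = TaylorGreenFamily.fam A B)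
    (hV : IsGalerkinSolution V S 0 c' fun _ _ _ => 0) (hsV : IsSupportedOn V S)
    (hV0 : V 0 = TaylorGreenFamily.fam B A) (hS : ∀ p ∈ S, swapXY.invK p ∈ S)
    (hS' : ∀ p ∈ S, swapXY.actK p ∈ S) (t : ℝ) : V t = swapXY.act (U t) :=
  eq_act swapXY hU hs hV hsV hS hS' (by rw [hV0, hU0, swapXY_act_fam]) t

/-- **PERMUTATION SYMMETRY, 3-cycle.** On a truncation mapped into itself by the coordinate cycle,
the inviscid run from `(C, A, B)` is the cycled run from `(A, B, C)`. [folklore] -/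
theorem fam_cycle_run {A B : ℝ} (hU : IsGalerkinSolution U S 0 c fun _ _ _ => 0)
    (hs : IsSupportedOn U S) (hU0 : U 0 = TaylorGreenFamily.fam A B)
    (hV : IsGalerkinSolution V S 0 c' fun _ _ _ => 0) (hsV : IsSupportedOn V S)
    (hV0 : V 0 = TaylorGreenFamily.fam (-(A + B)) A) (hS : ∀ p ∈ S, cycleXYZ.invK p ∈ S)
    (hS' : ∀ p ∈ S, cycleXYZ.actK p ∈ S) (t : ℝ) : V t = cycleXYZ.act (U t) :=
  eq_act cycleXYZ hU hs hV hsV hS hS' (by rw [hV0, hU0, cycleXYZ_act_fam]) t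

/-- **The enstrophy curves of `(A, B, C)` and `(B, A, C)` coincide** on every mode set `T` mapped
into itself by the swap. [cite: Ohkitani2001ODEEnstrophy, App. (A1)] -/
theorem fam_swap_truncEnstrophy {A B : ℝ} (hU : IsGalerkinSolution U S 0 c fun _ _ _ => 0)
    (hs : IsSupportedOn U S) (hU0 : U 0 = TaylorGreenFamily.fam A B)
    (hV : IsGalerkinSolution V S 0 c' fun _ _ _ => 0) (hsV : IsSupportedOn V S)
    (hV0 : V 0 = TaylorGreenFamily.fam B A) (hS : ∀ p ∈ S, swapXY.invK p ∈ S)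
    (hS' : ∀ p ∈ S, swapXY.actK p ∈ S) {T : Finset (Fin 3 → ℤ)}
    (hT : ∀ p ∈ T, swapXY.invK p ∈ T) (t : ℝ) :
    truncEnstrophy (V t) T = truncEnstrophy (U t) T := by
  rw [fam_swap_run hU hs hU0 hV hsV hV0 hS hS' t, swapXY.truncEnstrophy_act _ hT]

/-- **The enstrophy curves of `(A, B, C)` and `(C, A, B)` coincide** on every mode set mapped into
itself by the cycle. [cite: Ohkitani2001ODEEnstrophy, App. (A1)] -/
theorem fam_cycle_truncEnstrophy {A B : ℝ} (hU : IsGalerkinSolution U S 0 c fun _ _ _ => 0)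
    (hs : IsSupportedOn U S) (hU0 : U 0 = TaylorGreenFamily.fam A B)
    (hV : IsGalerkinSolution V S 0 c' fun _ _ _ => 0) (hsV : IsSupportedOn V S)
    (hV0 : V 0 = TaylorGreenFamily.fam (-(A + B)) A) (hS : ∀ p ∈ S, cycleXYZ.invK p ∈ S)
    (hS' : ∀ p ∈ S, cycleXYZ.actK p ∈ S) {T : Finset (Fin 3 → ℤ)}
    (hT : ∀ p ∈ T, cycleXYZ.invK p ∈ T) (t : ℝ) :
    truncEnstrophy (V t) T = truncEnstrophy (U t) T := by
  rw [fam_cycle_run hU hs hU0 hV hsV hV0 hS hS' t, cycleXYZ.truncEnstrophy_act _ hT]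

/-- Hence every Taylor coefficient of `Z_T` at `t = 0` is symmetric under `(A, B, C) ↦ (B, A, C)` …
[cite: Ohkitani2001ODEEnstrophy, App. (A1)] -/
theorem fam_swap_coeff {A B : ℝ} (hU : IsGalerkinSolution U S 0 c fun _ _ _ => 0)
    (hs : IsSupportedOn U S) (hU0 : U 0 = TaylorGreenFamily.fam A B)
    (hV : IsGalerkinSolution V S 0 c' fun _ _ _ => 0) (hsV : IsSupportedOn V S)
    (hV0 : V 0 = TaylorGreenFamily.fam B A) (hS : ∀ p ∈ S, swapXY.invK p ∈ S)
    (hS' : ∀ p ∈ S, swapXY.actK p ∈ S) {T : Finset (Fin 3 → ℤ)}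
    (hT : ∀ p ∈ T, swapXY.invK p ∈ T) (n : ℕ) :
    iteratedDeriv n (fun t => truncEnstrophy (V t) T) 0
      = iteratedDeriv n (fun t => truncEnstrophy (U t) T) 0 := by
  rw [show (fun t => truncEnstrophy (V t) T) = fun t => truncEnstrophy (U t) T from
    funext fun t => fam_swap_truncEnstrophy hU hs hU0 hV hsV hV0 hS hS' hT t]

/-- … and under the 3-cycle `(A, B, C) ↦ (C, A, B)`; the two generate all permutations.
[cite: Ohkitani2001ODEEnstrophy, App. (A1)] -/
theorem fam_cycle_coeff {A B : ℝ} (hU : IsGalerkinSolution U S 0 c fun _ _ _ => 0)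
    (hs : IsSupportedOn U S) (hU0 : U 0 = TaylorGreenFamily.fam A B)
    (hV : IsGalerkinSolution V S 0 c' fun _ _ _ => 0) (hsV : IsSupportedOn V S)
    (hV0 : V 0 = TaylorGreenFamily.fam (-(A + B)) A) (hS : ∀ p ∈ S, cycleXYZ.invK p ∈ S)
    (hS' : ∀ p ∈ S, cycleXYZ.actK p ∈ S) {T : Finset (Fin 3 → ℤ)}
    (hT : ∀ p ∈ T, cycleXYZ.invK p ∈ T) (n : ℕ) :
    iteratedDeriv n (fun t => truncEnstrophy (V t) T) 0
      = iteratedDeriv n (fun t => truncEnstrophy (U t) T) 0 := by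
  rw [show (fun t => truncEnstrophy (V t) T) = fun t => truncEnstrophy (U t) T from
    funext fun t => fam_cycle_truncEnstrophy hU hs hU0 hV hsV hV0 hS hS' hT t]

/-! ## Reynolds similarity with viscosity (appended): the uniqueness form for `ν ≠ 0` -/

/-- The scaled curve `t ↦ r û(r t)` of an UNFORCED Galerkin solution with viscosity `ν` solves the
unforced system with viscosity `r ν` (the tree's spelling of the zero forcing).
[cite: Frisch1995Turbulence, §2.2 p. 17 (scaling symmetries of Navier–Stokes)] -/
theorem isGalerkinSolution_scaleTime_unforced {ν : ℝ}
    (hU : IsGalerkinSolution U S ν c fun _ _ _ => 0) (r : ℝ) :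
    IsGalerkinSolution (fun t => scale r (U (r * t))) S (r * ν)
      (fun t k => (r : ℂ) ^ 2 * c (r * t) k) fun _ _ _ => 0 := by
  intro t k hk j
  refine (isGalerkinSolution_scaleTime hU r t k hk j).congr_deriv ?_
  simp [galerkinRHS]

/-- **REYNOLDS SIMILARITY (uniqueness form).** If `û` is the unforced Galerkin run with viscosity
`ν` and `V` the unforced run with viscosity `r ν` starting from `r û(0)` (both supported in `S`),
then `V(t) = r û(r t)` for all `t`: amplitude `× r`, viscosity `× r` and time `× 1/r` together are
a symmetry (same Reynolds number). [cite: Frisch1995Turbulence, §2.2 p. 17] -/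
theorem eq_scaleTime_visc {ν : ℝ} (hU : IsGalerkinSolution U S ν c fun _ _ _ => 0)
    (hs : IsSupportedOn U S) {r : ℝ} (hV : IsGalerkinSolution V S (r * ν) c' fun _ _ _ => 0)
    (hsV : IsSupportedOn V S) (h0 : V 0 = scale r (U 0)) (t : ℝ) :
    V t = scale r (U (r * t)) := by
  refine GalerkinODE.galerkin_unique S hV (isGalerkinSolution_scaleTime_unforced hU r) hsV
    (scaleTime_isSupportedOn hs r) (t₀ := 0) ?_ t
  show V 0 = scale r (U (r * 0))
  rw [mul_zero]
  exact h0

/-- … hence `Z_T(V(t)) = r² Z_T(û(r t))` and `E_T(V(t)) = r² E_T(û(r t))` on every mode set: the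
enstrophy and energy curves at equal Reynolds number are rescalings of one another. [folklore] -/
theorem truncEnstrophy_scaleTime_visc {ν : ℝ} (hU : IsGalerkinSolution U S ν c fun _ _ _ => 0)
    (hs : IsSupportedOn U S) {r : ℝ} (hV : IsGalerkinSolution V S (r * ν) c' fun _ _ _ => 0)
    (hsV : IsSupportedOn V S) (h0 : V 0 = scale r (U 0)) (t : ℝ) (T : Finset (Fin 3 → ℤ)) :
    truncEnstrophy (V t) T = r ^ 2 * truncEnstrophy (U (r * t)) T
      ∧ truncEnergy (V t) T = r ^ 2 * truncEnergy (U (r * t)) T := by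
  rw [eq_scaleTime_visc hU hs hV hsV h0 t, Galerkin.truncEnstrophy_scale,
    Galerkin.truncEnergy_scale]
  exact ⟨rfl, rfl⟩

end Summit.NavierStokesRegularity.FluidComputer.FamilySymmetry

end
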